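import Summits.Ventures.CertifiedManyBodySolver.Downfold.EmeryBoxesLa214DFTTrueCornerBandX0X0125
import Summits.Ventures.CertifiedManyBodySolver.Downfold.EmeryBoxesLa214OneBandImage
import Summits.Ventures.CertifiedManyBodySolver.Downfold.EmeryFermiScalePointsLa214Corners
import Summits.Ventures.CertifiedManyBodySolver.Downfold.EmeryOneBandImageBand
import Summits.Ventures.CertifiedManyBodySolver.Downfold.EmeryVanHoveLa214
import HarnessLib

/-!
# THE ONE-BAND IMAGE OF BOX #18 OVER A DOPING BAND — `emeryBoxLa214v123 ∩ {Δ_pd ∈ [1.7, 2.91]} (DFT-level Δ tag)`, x ∈ [0, 0.125] (ν ∈ [7/16, 1/2]; columns M13/M15(x0) … M15): ONE typed statement «∀ member θ ∀ filling ν ∈ [ν₁, ν₂]»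
# (INFL-3to1-B §B.98 THE DOPING CONTINUUM; kernel `EmeryOneBandImageBand`; router/ONE-BAND-IMAGE-BANDS.tsv)

Venture CertifiedManyBodySolver, cell `pub/hubbard-downfold` (stage S1), seat hubbard-downfold-mod-4 (technique B, g43); namespace `Summit.Ventures.CertifiedManyBodySolver.Downfold.Emery`.
Everything PROVED (0 sorry; no new certificate). DEVICE: at fixed θ every image coordinate is monotone in the Fermi energy (t_node ↓, w_node ↓, w_face ↓, w_axis ↓ in ε; corpus levers) and
ε_F(θ; ν) is non-decreasing in ν, so each coordinate at ν ∈ [ν₁, ν₂] lies between its values at the END fillings, which the landed column capstones `la214DFTBox_oneBandImage_x0` (x = 0) and `la214DFTBox_oneBandImage_x0125` (x = 1/8) window for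
every member; the box-wide Fermi-energy ceiling E_h = 487/200 (`cornerPt_la214BoxHi_x0_br` at half filling) carries the regime margins and the one box-wide upper-face-edge inequality `0 ≤ faceU(θ; E_h)` (four corners at the lowest t_pd, t_pp); t′/t by the true-corner band device `EmeryBoxesLa214DFTTrueCornerBandX0X0125`.
WHAT THIS IS NOT: a statement about La₂₋ₓSrₓCuO₄ — the typed box and its Δ_pd level tags are SCREENING-GRADE; `U = 0` one-body kinematics of the σ model (rigid band); no U number; not a phase word.

| box | doping band | t (eV) | t′/t | w_node | 4th / 5th coordinate |
|---|---|---|---|---|---|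
| emeryBoxLa214v123 ∩ {Δ_pd ∈ [1.7, 2.91]} (DFT-level Δ tag) | x ∈ [0, 0.125] (ν ∈ [7/16, 1/2]; columns M13/M15(x0) … M15) | [0.3683, 0.6313] | [-0.2926, -0.1890] | [0.5489, 0.7386] | HOLE-LIKE topology at every filling and zone-face antinodal weight `w_face ∈ [0.6173, 0.7767]` |

Sources: three-band model [HybertsenSchluterChristensen1989, Eq. (1)]; [AndersenEtAl1995, §6]; [folklore] algebra.
-/

noncomputable section

namespace Summit.Ventures.CertifiedManyBodySolver.Downfold.Emery

open Real Set

/-- **THE ONE-BAND IMAGE OF `emeryBoxLa214v123` — emeryBoxLa214v123 ∩ {Δ_pd ∈ [1.7, 2.91]} (DFT-level Δ tag) — OVER THE DOPING BAND x ∈ [0, 0.125] (ν ∈ [7/16, 1/2]; columns M13/M15(x0) … M15)**: for EVERY member θ AND EVERY filling ν of the band: `t ∈ [0.3683, 0.6313]` eV, `t′/t ∈ [-0.2926, -0.1890]`, `w_node ∈ [0.5489, 0.7386]`, HOLE-LIKE topology at every filling and zone-face antinodal weight `w_face ∈ [0.6173, 0.7767]`. Pure composition: kernel `EmeryOneBandImageBand`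 (filling levers) + the two END-column capstones `la214DFTBox_oneBandImage_x0` / `la214DFTBox_oneBandImage_x0125` + the t′/t true-corner band `la214DFTBox_fsRatio_true_band_x0_x0125`. [folklore] -/
theorem la214DFTBox_oneBandImage_band_x0_x0125 {Δ a b c ν : ℝ} (hΔ : Δ ∈ Icc ((17 : ℝ) / 10) ((291 : ℝ) / 100)) (ha : a ∈ Icc ((129 : ℝ) / 100) ((38 : ℝ) / 25)) (hb : b ∈ Icc ((23 : ℝ) / 50) ((33 : ℝ) / 50)) (hc : c ∈ Icc ((3 : ℝ) / 25) ((3 : ℝ) / 20)) (hν : ν ∈ Icc ((7 : ℝ) / 16) ((1 : ℝ) / 2)) :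
    scaleT Δ a b c (xNode Δ a b c (fermiEnergyOf Δ a b c ν)) (xNode Δ a b c (fermiEnergyOf Δ a b c ν)) (fermiEnergyOf Δ a b c ν) ∈ Icc (3683/10000 : ℝ) (6313/10000 : ℝ) ∧
      fsRatio Δ a b c (fermiEnergyOf Δ a b c ν) ∈ Icc ((-1463 : ℝ) / 5000) ((-189 : ℝ) / 1000) ∧
      dWeightNode Δ a b c (fermiEnergyOf Δ a b c ν) ∈ Icc ((5489 : ℝ) / 10000) ((3693 : ℝ) / 5000) ∧
      (0 < faceG Δ a c (fermiEnergyOf Δ a b c ν) ∧ 1 < xAxis Δ a c (fermiEnergyOf Δ a b c ν)) ∧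
        dWeightFace Δ a b c (fermiEnergyOf Δ a b c ν) ∈ Icc ((6173 : ℝ) / 10000) ((7767 : ℝ) / 10000) := by
  have hΔ0 : 0 < Δ := lt_of_lt_of_le (by norm_num) hΔ.1
  have ha0 : 0 < a := lt_of_lt_of_le (by norm_num) ha.1
  have hc0 : 0 ≤ c := le_trans (by norm_num) hc.1
  have hcb : c ≤ b := hc.2.trans (le_trans (by norm_num) hb.1)
  have hb0 : 0 ≤ b := hc0.trans hcb
  have hΔw : Δ ∈ Icc ((17 : ℝ) / 10) (4 : ℝ) := ⟨le_trans (by norm_num) hΔ.1, le_trans hΔ.2 (by norm_num)⟩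
  -- the two END columns (landed capstones)
  have h2 := la214DFTBox_oneBandImage_x0 hΔ ha hb hc
  have h1 := la214DFTBox_oneBandImage_x0125 hΔ ha hb hc
  -- the box-wide Fermi-energy ceiling E_h = 487/200 (corner (1.7, 1.52, 0.66, 0.12) at half filling) serves every band
  have hT := (fermiEnergyOf_of_pointBracketCheck cornerPt_la214BoxHi_x0_br (by norm_num) (by norm_num) (by norm_num) (ν := (1/2 : ℝ)) (by push_cast; exact ⟨le_rfl, le_rfl⟩)).2
  push_cast at hT
  have hbox := fermiEnergyOf_mem_Icc_of_mem_box' (ν := ((1 : ℝ) / 2)) (by norm_num) (by norm_num) (by norm_num) (by norm_num) hΔw ha hb hc (by norm_num) (by norm_num)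
  have hhalf : ((1 : ℝ) / 2) = (1/2 : ℝ) := by norm_num
  have hEh0 : fermiEnergyOf Δ a b c ((1 : ℝ) / 2) ≤ ((487 : ℝ) / 200) := by
    refine hbox.2.trans ?_
    rw [hhalf]; exact hT.2
  have hEh : fermiEnergyOf Δ a b c ((1 : ℝ) / 2) ≤ ((487 : ℝ) / 200) :=
    fermiEnergyOf_le_of_band (ν₂ := ((1 : ℝ) / 2)) hΔ0 ha0.ne' hc0 hb0 (by norm_num) (by norm_num) (by norm_num) hEh0
  have ha2 : ((129 : ℝ) / 100) ^ 2 ≤ a ^ 2 := pow_le_pow_left₀ (by norm_num) ha.1 2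
  have hm : c * (((487 : ℝ) / 200)) < a ^ 2 := by nlinarith [hc.2]
  have hq : b * Δ < 4 * a ^ 2 := by nlinarith [mul_le_mul hb.2 hΔw.2 hΔ0.le (by norm_num : (0 : ℝ) ≤ (33 : ℝ) / 50)]
  -- the upper face edge at E_h over the box from four corners at the lowest t_pd / t_pp
  have hU : 0 ≤ faceU Δ a b c ((487 : ℝ) / 200) :=
    faceU_nonneg_on_box4 (Δ₁ := ((17 : ℝ) / 10)) (Δ₂ := ((291 : ℝ) / 100)) (a₁ := ((129 : ℝ) / 100)) (b₁ := ((23 : ℝ) / 50)) (c₁ := ((3 : ℝ) / 25)) (c₂ := ((3 : ℝ) / 20))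
      (by norm_num) (by norm_num) (by norm_num) (by norm_num) (by norm_num) hΔ ha.1 hb.1 hc
      (by norm_num [faceU_eq]) (by norm_num [faceU_eq]) (by norm_num [faceU_eq]) (by norm_num [faceU_eq])
  -- hole-likeness floor of the whole box (x_VH ≥ 9911/73728 = 0.1344, `la214Box_xVH`)
  have hx : (9911 / 73728 : ℝ) ≤ xVH Δ a b c := (la214Box_xVH hΔw (by simpa using ha) (by simpa using hb) (by simpa using hc)).2.2.2.1
  refine ⟨?_, la214DFTBox_fsRatio_true_band_x0_x0125 hΔ ha hb hc hν, ?_, ?_, ?_⟩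
  · exact scaleT_node_fermiEnergyOf_mem_Icc_of_band hΔ0 ha0.ne' hc0 hcb (by norm_num) hν (by norm_num) hEh hm hq h2.1.1 h1.1.2
  · exact dWeightNode_fermiEnergyOf_mem_Icc_of_band hΔ0 ha0.ne' hc0 hcb (by norm_num) hν (by norm_num) h2.2.2.1.1 h1.2.2.1.2
  · exact holeLike_of_band (X := (9911 / 73728 : ℝ)) hΔ0 ha0 hc0 hb0 (by norm_num) hν (by norm_num) hx (by norm_num) hEh hm
  · exact dWeightFace_fermiEnergyOf_mem_Icc_of_band (X := (9911 / 73728 : ℝ)) hΔ0 ha0 hc0 hcb (by norm_num) hν (by norm_num) hx (by norm_num) hEh hm hU h2.2.2.2.1 h1.2.2.2.2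

end Summit.Ventures.CertifiedManyBodySolver.Downfold.Emery
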